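import Literature.Barriers.PneNP.TSPExtensionComplexityGadgetBlocks
import Literature.Barriers.PneNP.TSPExtensionComplexityGadgetIneq
import HarnessLib

/-!
# The TSP gadget graph: the designated tours `T_b` and their bits

Support file for the discharge of `Literature.Barriers.PneNP.TSPExtensionComplexity` (FMPTW
2015, Thm. 12). For `b ⊆ [n]` the tour `T_b` is `cycEdges (tourList pad b)`, where `tourList pad b`
concatenates the blocks `blk b u` of the previous file over all keys `u` (in the arbitrary
order of `Finset.univ.toList` — block junctions are skeleton–skeleton, i.e. clique, edges, so the
order is immaterial). We prove:

* `tourList pad b` lists every vertex exactly once and is a closed path of the gadget graph, hence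
  `isTourOn_tourEdges : IsTourOn (tourEdges pad b)` and
  `tourEdges_subset : T_b ⊆ E(gadgetGraph)` (no penalty);
* the readouts `ge_mem_tourEdges_iff : ge i ∈ T_b ↔ i ∉ b` (bit `B_i(T_b) = [i ∈ b]`) and
  `rpe_mem_tourEdges_iff : rpe (i,j) ∈ T_b ↔ ¬(i ∈ b ∧ j ∈ b)` (`Y_{ij}(T_b) = [i ∈ b][j ∈ b]`),
  the positive directions by exhibiting consecutive vertices of a block, the negative ones by
  degree two at `s₀(i,0)` resp. at `P`.

All [folklore].
-/

namespace Literature.Barriers.PneNP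

open GV Finset

variable {n pad : ℕ} (b : Finset (Fin n))

variable (pad) in
/-- The vertex sequence of the designated tour `T_b` (the padding size `pad` is explicit).
[folklore] -/
noncomputable def tourList : List (GV n pad) :=
  (Finset.univ : Finset (GV n pad)).toList.flatMap (blk b)

variable (pad) in
/-- The designated tour `T_b` as an edge set. [folklore] -/
noncomputable def tourEdges : Finset (Sym2 (GV n pad)) := cycEdges (tourList pad b)

/-! ### `tourList pad b` is a Hamiltonian cycle of the gadget graph -/

/-- Every vertex is listed. [folklore] -/
theorem mem_tourList (v : GV n pad) : v ∈ tourList pad b :=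
  List.mem_flatMap.2 ⟨owner b v, Finset.mem_toList.2 (mem_univ _), mem_blk_owner b v⟩

/-- Distinct keys have disjoint blocks. [folklore] -/
theorem disjoint_blk {u u' : GV n pad} (h : u ≠ u') : List.Disjoint (blk b u) (blk b u') :=
  fun _ hv hv' => h ((owner_eq_of_mem_blk b hv).symm.trans (owner_eq_of_mem_blk b hv'))

/-- No vertex is listed twice. [folklore] -/
theorem nodup_tourList : (tourList pad b).Nodup := by
  rw [tourList, List.nodup_flatMap]
  refine ⟨fun u _ => nodup_blk b u, ?_⟩
  exact (Finset.nodup_toList _).pairwise_of_forall_ne fun u _ u' _ h => disjoint_blk b h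

/-- The length of `tourList pad b` is the number of vertices. [folklore] -/
theorem length_tourList : (tourList pad b).length = Fintype.card (GV n pad) := by
  rw [← List.toFinset_card_of_nodup (nodup_tourList b), ← Finset.card_univ]
  congr 1
  exact eq_univ_iff_forall.2 fun v => List.mem_toFinset.2 (mem_tourList b v)

/-- … which is at least `17` once `n ≥ 1`. [folklore] -/
theorem length_tourList_ge (hn : 0 < n) : 17 ≤ (tourList pad b).length := by
  rw [length_tourList, GV.card]
  nlinarith

/-- [folklore] -/
theorem tourList_ne_nil (hn : 0 < n) : tourList pad b ≠ [] := by
  intro h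
  have := length_tourList_ge (pad := pad) b hn
  rw [h] at this
  simp at this

/-- The head of a nonempty concatenation is the head of one of its nonempty members.
[folklore] -/
theorem head_flatten_mem {α : Type*} :
    ∀ (L : List (List α)) (h : L.flatten ≠ []),
      ∃ l ∈ L, ∃ hl : l ≠ [], L.flatten.head h = l.head hl
  | [], h => absurd rfl h
  | l :: L, h => by
    by_cases hl : l = []
    · subst hl
      have h' : L.flatten ≠ [] := by simpa using h
      obtain ⟨l', hl', hne, heq⟩ := head_flatten_mem L h'
      refine ⟨l', List.mem_cons_of_mem _ hl', hne, ?_⟩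
      rw [← heq]
      simp
    · refine ⟨l, List.mem_cons_self, hl, ?_⟩
      simp only [List.flatten_cons]
      exact List.head_append_of_ne_nil hl

/-- The last element of a nonempty concatenation is the last element of one of its nonempty
members. [folklore] -/
theorem getLast_flatten_mem {α : Type*} :
    ∀ (L : List (List α)) (h : L.flatten ≠ []),
      ∃ l ∈ L, ∃ hl : l ≠ [], L.flatten.getLast h = l.getLast hl
  | [], h => absurd rfl h
  | l :: L, h => by
    by_cases hL : L.flatten = []
    · have hl : l ≠ [] := by simpa [hL] using h
      refine ⟨l, List.mem_cons_self, hl, ?_⟩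
      simp only [List.flatten_cons]
      rw [List.getLast_append_left]
      simpa using hL
    · obtain ⟨l', hl', hne, heq⟩ := getLast_flatten_mem L hL
      refine ⟨l', List.mem_cons_of_mem _ hl', hne, ?_⟩
      simp only [List.flatten_cons]
      rw [List.getLast_append_of_ne_nil _ hL, heq]

/-- `tourList pad b` starts at a skeleton vertex. [folklore] -/
theorem skel_head_tourList (h : tourList pad b ≠ []) :
    skel ((tourList pad b).head h) = true := by
  have h' : ((univ : Finset (GV n pad)).toList.map (blk b)).flatten ≠ [] := by
    rwa [← List.flatMap_def]
  obtain ⟨l, hl, hne, heq⟩ := head_flatten_mem _ h'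
  obtain ⟨u, -, rfl⟩ := List.mem_map.1 hl
  have : (tourList pad b).head h = (blk b u).head hne := by
    rw [← heq]; congr 1
  rw [this, head_blk b hne]
  exact skel_of_blk_ne_nil b hne

/-- `tourList pad b` ends at a skeleton vertex. [folklore] -/
theorem skel_getLast_tourList (h : tourList pad b ≠ []) :
    skel ((tourList pad b).getLast h) = true := by
  have h' : ((univ : Finset (GV n pad)).toList.map (blk b)).flatten ≠ [] := by
    rwa [← List.flatMap_def]
  obtain ⟨l, hl, hne, heq⟩ := getLast_flatten_mem _ h'
  obtain ⟨u, -, rfl⟩ := List.mem_map.1 hl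
  have : (tourList pad b).getLast h = (blk b u).getLast hne := by
    rw [← heq]; congr 1
  rw [this]
  exact skel_getLast_blk b hne

/-- `tourList pad b` is a path of the gadget graph. [folklore] -/
theorem isChain_tourList : List.IsChain (gadgetGraph n pad).Adj (tourList pad b) := by
  classical
  rw [tourList, List.flatMap_def, ← List.flatten_filter_ne_nil]
  rw [List.isChain_flatten (by simp)]
  refine ⟨fun l hl => ?_, ?_⟩
  · obtain ⟨hl, -⟩ := List.mem_filter.1 hl
    obtain ⟨u, -, rfl⟩ := List.mem_map.1 hl
    exact isChain_blk b u
  · refine List.Pairwise.isChain (List.Pairwise.filter _ ?_)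
    rw [List.pairwise_map]
    refine (Finset.nodup_toList _).pairwise_of_forall_ne fun u _ u' _ hne => ?_
    intro v hv w hw
    have hne1 : blk b u ≠ [] := by rintro h; simp [h] at hv
    have hne2 : blk b u' ≠ [] := by rintro h; simp [h] at hw
    rw [List.getLast?_eq_some_getLast hne1] at hv
    rw [List.head?_eq_some_head hne2] at hw
    simp only [Option.mem_def, Option.some.injEq] at hv hw
    subst hv; subst hw
    rw [head_blk b hne2]
    refine adj_of_skel (skel_getLast_blk b hne1) (skel_of_blk_ne_nil b hne2) fun heq => ?_
    have h1 : (blk b u).getLast hne1 ∈ blk b u := List.getLast_mem hne1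
    have h2 : u' ∈ blk b u' := by
      have h2 := List.head_mem hne2
      rwa [head_blk b hne2] at h2
    rw [heq] at h1
    exact disjoint_blk b hne h1 h2

/-- In a list without repetition of length `≥ 2` the last element differs from the first.
[folklore] -/
theorem getLast_ne_head_of_nodup {α : Type*} :
    ∀ (l : List α) (h : l ≠ []), l.Nodup → 2 ≤ l.length → l.getLast h ≠ l.head h
  | [], h, _, _ => absurd rfl h
  | [_], _, _, h2 => by simp at h2
  | v :: w :: l, _, hnd, _ => by
    intro heq
    have hmem : (v :: w :: l).getLast (by simp) ∈ w :: l := by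
      rw [List.getLast_cons (by simp)]
      exact List.getLast_mem _
    rw [heq] at hmem
    exact (List.nodup_cons.1 hnd).1 hmem

/-- The tour closes up through a clique edge. [folklore] -/
theorem adj_getLast_head_tourList (hn : 0 < n) :
    (gadgetGraph n pad).Adj ((tourList pad b).getLast (tourList_ne_nil b hn))
      ((tourList pad b).head (tourList_ne_nil b hn)) :=
  adj_of_skel (skel_getLast_tourList b _) (skel_head_tourList b _)
    (getLast_ne_head_of_nodup _ _ (nodup_tourList b)
      (by have := length_tourList_ge (pad := pad) b hn; omega))

/-- **`T_b` is a tour.** [folklore] -/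
theorem isTourOn_tourEdges (hn : 0 < n) : IsTourOn (tourEdges pad b) :=
  isTourOn_cycEdges (nodup_tourList b) (mem_tourList b)
    (by have := length_tourList_ge (pad := pad) b hn; omega)

/-- **`T_b` lies inside the gadget graph** (no penalty). [folklore] -/
theorem tourEdges_subset (hn : 0 < n) : ∀ e ∈ tourEdges pad b, e ∈ (gadgetGraph n pad).edgeSet :=
  cycEdges_subset_edgeSet (tourList_ne_nil b hn) (isChain_tourList b)
    (adj_getLast_head_tourList b hn)

/-! ### Edges of `T_b` from consecutive vertices of a block -/

/-- Every block is a contiguous piece of `tourList pad b`. [folklore] -/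
theorem blk_infix (u : GV n pad) : ∃ pre post, tourList pad b = pre ++ blk b u ++ post := by
  obtain ⟨s, t, hst⟩ := List.append_of_mem (Finset.mem_toList.2 (mem_univ u))
  refine ⟨s.flatMap (blk b), t.flatMap (blk b), ?_⟩
  rw [tourList, hst, List.flatMap_append, List.flatMap_cons, List.append_assoc]

/-- Consecutive vertices of a block span an edge of `T_b`. [folklore] -/
theorem mem_tourEdges_of_blk {u v w : GV n pad} (p₁ p₂ : List (GV n pad))
    (h : blk b u = p₁ ++ v :: w :: p₂) : s(v, w) ∈ tourEdges pad b := by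
  obtain ⟨pre, post, hl⟩ := blk_infix b u
  rw [tourEdges, hl, h]
  have : pre ++ (p₁ ++ v :: w :: p₂) ++ post = (pre ++ p₁) ++ v :: w :: (p₂ ++ post) := by
    simp [List.append_assoc]
  rw [this]
  exact mem_cycEdges_append _ _ _ _

/-! ### The bits of `T_b` -/

/-- For `i ∉ b` the chain block starts `g i false, s₀(i,0), …`. [folklore] -/
theorem chainBlock_eq_of_not_mem {i : Fin n} (hi : i ∉ b) :
    ∃ rest, (chainBlock b i : List (GV n pad)) = g i false :: x i ⟨0, i.pos⟩ 2 0 :: rest := by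
  obtain ⟨m, hm⟩ : ∃ m, n = m + 1 := ⟨n - 1, by have := i.pos; omega⟩
  have h1 : (chainTail i n le_rfl : List (GV n pad)) = chainTail i (m + 1) (by omega) := by
    congr 1
  have h2 : (chainTail i (m + 1) (by omega) : List (GV n pad)) =
      botPath i ⟨0, i.pos⟩ ++ chainTail i m (by omega) := by
    rw [chainTail]
    congr 3
    omega
  unfold chainBlock chainBody
  rw [if_neg hi, h1, h2]
  exact ⟨_, rfl⟩

/-- For `i ∈ b` the top row of every `X_(i,j)` is traversed inside the block owning it.
[folklore] -/
theorem topPath_infix_blk {i : Fin n} (hi : i ∈ b) (j : Fin n) :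
    ∃ p₁ p₂, (blk b (owner b (x i j 0 0)) : List (GV n pad)) = p₁ ++ topPath i j ++ p₂ := by
  simp only [owner, hi, if_true]
  by_cases hij : i = j
  · subst hij
    simp only [if_true, blk, lt_irrefl, if_false, diagBlock, hi]
    exact ⟨[a i i 0], [a i i 1], by simp⟩
  · simp only [hij, if_false]
    by_cases hlt : i < j
    · simp only [hlt, if_true, blk, pairBlock, pairBody, hi]
      by_cases hj : j ∈ b
      · simp only [hj, if_true]
        exact ⟨[a j i 0, a i j 0], a i j 1 :: (topPath j i ++ [a i j 2]) ++ [a j i 1], by simp⟩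
      · simp only [hj, if_false]
        exact ⟨[a j i 0, a i j 2, a i j 0], [a i j 1] ++ [a j i 1], by simp⟩
    · have hgt : j < i := lt_of_le_of_ne (not_lt.1 hlt) (Ne.symm hij)
      simp only [hlt, if_false, blk, hgt, if_true, pairBlock, pairBody, hi]
      by_cases hj : j ∈ b
      · simp only [hj, if_true]
        exact ⟨a i j 0 :: a j i 0 :: (topPath j i ++ [a j i 1]), [a j i 2] ++ [a i j 1], by simp⟩
      · simp only [hj, if_false]
        exact ⟨[a i j 0, a j i 1], [a j i 2, a j i 0] ++ [a i j 1], by simp⟩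

/-- **Bit readout**: the chain edge `ge i` is a tour edge of `T_b` iff `i ∉ b`, i.e.
`B_i(T_b) = [i ∈ b]`. [folklore] -/
theorem ge_mem_tourEdges_iff (hn : 0 < n) (i : Fin n) :
    ge i ∈ tourEdges pad b ↔ i ∉ b := by
  constructor
  · intro hge hi
    obtain ⟨p₁, p₂, hblk⟩ := topPath_infix_blk b hi ⟨0, hn⟩
    have e1 : s(x i ⟨0, hn⟩ 1 0, x i ⟨0, hn⟩ 2 0) ∈ tourEdges pad b :=
      mem_tourEdges_of_blk b (p₁ ++ [x i ⟨0, hn⟩ 0 0])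
        ([x i ⟨0, hn⟩ 2 1, x i ⟨0, hn⟩ 1 1, x i ⟨0, hn⟩ 0 1, x i ⟨0, hn⟩ 0 2, x i ⟨0, hn⟩ 1 2,
          x i ⟨0, hn⟩ 2 2, x i ⟨0, hn⟩ 2 3, x i ⟨0, hn⟩ 1 3, x i ⟨0, hn⟩ 0 3] ++ p₂)
        (by rw [hblk]; simp [topPath])
    have e2 : s(x i ⟨0, hn⟩ 2 0, x i ⟨0, hn⟩ 2 1) ∈ tourEdges pad b :=
      mem_tourEdges_of_blk b (p₁ ++ [x i ⟨0, hn⟩ 0 0, x i ⟨0, hn⟩ 1 0])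
        ([x i ⟨0, hn⟩ 1 1, x i ⟨0, hn⟩ 0 1, x i ⟨0, hn⟩ 0 2, x i ⟨0, hn⟩ 1 2,
          x i ⟨0, hn⟩ 2 2, x i ⟨0, hn⟩ 2 3, x i ⟨0, hn⟩ 1 3, x i ⟨0, hn⟩ 0 3] ++ p₂)
        (by rw [hblk]; simp [topPath])
    have hT := isTourOn_tourEdges (pad := pad) b hn
    rcases hT.eq_or_eq_of_mem e1 e2 (by simp) (Sym2.mem_mk_right _ _) (Sym2.mem_mk_left _ _) hge
        (by simp [ge]) with h | h
    · simp [ge] at h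
    · simp [ge] at h
  · intro hi
    obtain ⟨rest, hrest⟩ := chainBlock_eq_of_not_mem b hi
    have : s(g i false, x i ⟨0, i.pos⟩ 2 0) ∈ tourEdges pad b :=
      mem_tourEdges_of_blk b (u := g i false) [] rest (by simpa [blk] using hrest)
    rw [ge, Sym2.eq_swap]
    exact this

/-- **Pair readout** for `y < x`: the plain edge `{R, P}` is a tour edge of `T_b` iff not
both bits are set. [folklore] -/
theorem rp_mem_tourEdges_iff (hn : 0 < n) {y x' : Fin n} (hyx : y < x') :
    s(a y x' 2, a y x' 0) ∈ tourEdges pad b ↔ ¬(y ∈ b ∧ x' ∈ b) := by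
  have hne : y ≠ x' := hyx.ne
  have hblk : (blk b (a x' y 0) : List (GV n pad)) = a x' y 0 :: (pairBody b y x' ++ [a x' y 1]) := by
    simp [blk, hyx, pairBlock]
  constructor
  · rintro h ⟨hy, hx⟩
    have hbody : (pairBody b y x' : List (GV n pad)) =
        a y x' 0 :: (topPath y x' ++ a y x' 1 :: (topPath x' y ++ [a y x' 2])) := by
      simp [pairBody, hy, hx]
    have e1 : s(a x' y 0, a y x' 0) ∈ tourEdges pad b :=
      mem_tourEdges_of_blk b (u := a x' y 0) []
        (topPath y x' ++ a y x' 1 :: (topPath x' y ++ [a y x' 2]) ++ [a x' y 1])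
        (by rw [hblk, hbody]; simp)
    have e2 : s(a y x' 0, x y x' 0 0) ∈ tourEdges pad b :=
      mem_tourEdges_of_blk b (u := a x' y 0) [a x' y 0]
        ([x y x' 1 0, x y x' 2 0, x y x' 2 1, x y x' 1 1, x y x' 0 1, x y x' 0 2, x y x' 1 2,
          x y x' 2 2, x y x' 2 3, x y x' 1 3, x y x' 0 3] ++
          a y x' 1 :: (topPath x' y ++ [a y x' 2]) ++ [a x' y 1])
        (by rw [hblk, hbody]; simp [topPath])
    have hT := isTourOn_tourEdges (pad := pad) b hn
    rcases hT.eq_or_eq_of_mem e1 e2 (by simp [hne]) (Sym2.mem_mk_right _ _)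
        (Sym2.mem_mk_left _ _) h (Sym2.mem_mk_right _ _) with h' | h'
    · simp [hne] at h'
    · simp at h'
  · intro h
    by_cases hy : y ∈ b
    · have hx : x' ∉ b := fun hx => h ⟨hy, hx⟩
      have hbody : (pairBody b y x' : List (GV n pad)) = a y x' 2 :: a y x' 0 :: (topPath y x' ++ [a y x' 1]) := by
        simp [pairBody, hy, hx]
      exact mem_tourEdges_of_blk b (u := a x' y 0) [a x' y 0]
        (topPath y x' ++ [a y x' 1] ++ [a x' y 1]) (by rw [hblk, hbody]; simp)
    · by_cases hx : x' ∈ b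
      · have hbody : (pairBody b y x' : List (GV n pad)) = a y x' 1 :: (topPath x' y ++ [a y x' 2, a y x' 0]) := by
          simp [pairBody, hy, hx]
        exact mem_tourEdges_of_blk b (u := a x' y 0) (a x' y 0 :: a y x' 1 :: topPath x' y)
          [a x' y 1] (by rw [hblk, hbody]; simp)
      · have hbody : (pairBody b y x' : List (GV n pad)) = [a y x' 2, a y x' 0, a y x' 1] := by
          simp [pairBody, hy, hx]
        exact mem_tourEdges_of_blk b (u := a x' y 0) [a x' y 0] [a y x' 1, a x' y 1]
          (by rw [hblk, hbody]; simp)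

/-- **Pair readout** through `rpe`: `Y_{ij}(T_b) = [i ∈ b ∧ j ∈ b]`. [folklore] -/
theorem rpe_mem_tourEdges_iff (hn : 0 < n) {i j : Fin n} (hij : i ≠ j) :
    rpe (i, j) ∈ tourEdges pad b ↔ ¬(i ∈ b ∧ j ∈ b) := by
  rcases lt_or_gt_of_ne hij with h | h
  · have : (rpe (i, j) : Sym2 (GV n pad)) = s(a i j 2, a i j 0) := by simp [rpe, h]
    rw [this]
    exact rp_mem_tourEdges_iff b hn h
  · have : (rpe (i, j) : Sym2 (GV n pad)) = s(a j i 2, a j i 0) := by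
      simp [rpe, not_lt.2 h.le]
    rw [this, rp_mem_tourEdges_iff b hn h]
    tauto

/-! ### The slack of `T_b` in the inequality of `a` -/

/-- The bit count of `T_b` on `a`: `#{i ∈ a : ge i ∈ T_b} = |a ∖ b|`. [folklore] -/
theorem card_filter_ge (hn : 0 < n) (a : Finset (Fin n)) :
    (a.filter fun i => ge i ∈ tourEdges pad b).card = (a \ b).card := by
  congr 1
  rw [sdiff_eq_filter]
  exact filter_congr fun i _ => ge_mem_tourEdges_iff b hn i

/-- The pair count of `T_b` on `a`: `#{p ∈ a.offDiag : rpe p ∈ T_b} = |a.offDiag| -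
|(a ∩ b).offDiag|`. [folklore] -/
theorem card_filter_rpe (hn : 0 < n) (a : Finset (Fin n)) :
    (a.offDiag.filter fun p => rpe p ∈ tourEdges pad b).card =
      a.offDiag.card - (a ∩ b).offDiag.card := by
  have hsub : (a ∩ b).offDiag ⊆ a.offDiag := offDiag_mono inter_subset_left
  rw [← card_sdiff_of_subset hsub]
  congr 1
  ext p
  simp only [mem_filter, mem_sdiff, mem_offDiag, mem_inter]
  constructor
  · rintro ⟨hp, hr⟩
    refine ⟨hp, fun h => ?_⟩
    exact (rpe_mem_tourEdges_iff b hn hp.2.2).1 hr ⟨h.1.2, h.2.1.2⟩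
  · rintro ⟨hp, h⟩
    refine ⟨hp, (rpe_mem_tourEdges_iff b hn hp.2.2).2 fun hb => h ?_⟩
    exact ⟨⟨hp.1, hb.1⟩, ⟨hp.2.1, hb.2⟩, hp.2.2⟩

/-- **The slack of the designated tour**: the value of the inequality of `a` at `T_b` is
`|a.offDiag| - |a| + 1 - (|a ∩ b| - 1)²`, i.e. the slack is `(1 - |a ∩ b|)²` — the
unique-disjointness pattern (FMPTW Lemma 6: "the slack of vertex `bbᵀ` … is precisely
`M_ab = (1 - aᵀb)²`"). [cite: FioriniEtAl2015, Lemma 6 (PDF p. 9)] -/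
theorem val_tourEdges (hn : 0 < n) (a : Finset (Fin n)) :
    ((a.offDiag.filter fun p => rpe p ∈ tourEdges pad b).card : ℤ) -
        ((a.filter fun i => ge i ∈ tourEdges pad b).card : ℤ) -
        (n : ℤ) ^ 2 * (((tourEdges pad b).filter fun e => e ∉ (gadgetGraph n pad).edgeSet).card : ℤ)
      = (a.offDiag.card : ℤ) - a.card + 1 - ((a ∩ b).card - 1) ^ 2 := by
  have h0 : ((tourEdges pad b).filter fun e => e ∉ (gadgetGraph n pad).edgeSet).card = 0 := by
    rw [card_eq_zero, filter_eq_empty_iff]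
    exact fun e he h => h (tourEdges_subset b hn e he)
  rw [h0, card_filter_ge b hn, card_filter_rpe b hn]
  have hsub : (a ∩ b).offDiag ⊆ a.offDiag := offDiag_mono inter_subset_left
  have h1 := card_le_card hsub
  have h2 : (a \ b).card + (a ∩ b).card = a.card := card_sdiff_add_card_inter a b
  have h3 : (a ∩ b).offDiag.card = (a ∩ b).card * (a ∩ b).card - (a ∩ b).card := offDiag_card _
  have hk : (a ∩ b).card ≤ (a ∩ b).card * (a ∩ b).card := Nat.le_mul_self _
  rw [Nat.cast_sub h1, h3, Nat.cast_sub hk]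
  push_cast
  have h2' : ((a \ b).card : ℤ) = a.card - (a ∩ b).card := by
    have := h2; omega
  rw [h2']
  ring

end Literature.Barriers.PneNP
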